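import Literature.MathematicalPhysics.QuantumFieldTheory.Balaban1983to89.Beta.Envelope

/-!
# NE7EJBracketField — row NE7 (node U5), candidate route HOM, variant H1L-EJ: (E2) ∕ (E4) AS ANALYTIC IDENTITIES — THE QUADRATIC
# JUNCTION BRACKET OVER AN ARBITRARY FIELD (symmetric, NOT Hermitian, forms: «only the SIGN information is lost off the real slice»)

Lineage `b2b-balaban-t4-ne7-p2` (CRUX PROVER NE7 #2 = C-HOM°'s kernel hand), generation 80; file 110 (companion of 108 `NE7EJBracketForms`,
independent of 106–109).  CONSUMER SHAPES (by name): lens 1's EJ-1b′ (`t4/ideate/NE7/lens1-g58/DEFECT-NOTE.md` §2 (E2) CONTENT: «For the analytic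
continuations in V … the identity Br = 𝔇(U^A) − R₂ persists VERBATIM with R₂ = the second-order Taylor remainder of A_B at the complex critical
point U^B (criticality δA_B(U^B)|_{T S_V} = 0 is an analytic identity in V, hence continues); only the SIGN information is lost off the real
slice») and lens 2's S-91-1 (`t4/ideate/NE7/lens2-g91/ENVELOPE-SUPPLY.md` §2: «(E4) … q(τ) := ⟨P d𝔇(U_τ), H_τ^{−1} P d𝔇(U_τ)⟩ (BILINEAR pairing …)
… All three are ANALYTIC IDENTITIES in V wherever … (H-inv) holds (no signs, no minimality used)»; §3 (ii) «COMPLEX DOMAIN, θ-FREE … |R₂(V)| ≤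
½·sup‖H_τ(V)^{−1}‖·|P d𝔇(U_τ(V))|²»).  At the quadratic level the «analytic continuation» is literal: every identity of file 108 §4–§5 holds
over ANY field `𝕜` (in particular `ℂ`) for SYMMETRIC (`Kᵀ = K`, not conjugate-symmetric) invertible forms with invertible block propagators —
the hypothesis (H-inv) — with BILINEAR pairings `x ⬝ᵥ M *ᵥ y` (no `star`), and nothing but the positivity statements is lost.

WHAT IS PROVED ([folklore]; `𝕜` any field; `K₀`, `K₁` symmetric with `IsUnit Kᵢ.det`, `IsUnit (blockProp Kᵢ Q).det`; `E := K₁ − K₀`; an1's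
`Beta.Envelope` BY NAME — `minMap` H, `blockProp` P, `constrProp` G, `value_sub_value`, `minMap_sub_minMap`, `constrProp_mul_mul_constrProp`,
`quad_eq_quad_minMap_add`):
* §1 `constrProp_transpose_of_symm`, `blockProp_transpose_of_symm`, `blockPropInv_transpose_of_symm`.
* §2 **(E2) AS MATRIX IDENTITIES**: `minMap_sub_eq` (`H₀ − H₁ = G₁ E H₀`, the exact minimiser response), **`value_sub_value_second`**
  (`P₁⁻¹ − P₀⁻¹ = H₀ᵀEH₀ − (EH₀)ᵀG₁(EH₀)`), **`value_sub_value_second'`** (`= H₁ᵀEH₁ + (EH₁)ᵀG₀(EH₁)`), `remB_matrix` (`R₂ := H₀ᵀEH₀ − (P₁⁻¹ − P₀⁻¹)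
  = (EH₀)ᵀG₁(EH₀)`), **`remB_matrix_eq_hessian_form`** (`R₂ = (H₀ − H₁)ᵀ K₁ (H₀ − H₁)` — lens 1's «R₂ = ½⟨W, Hess A_B W⟩, W = U^A − U^B, NO
  first-order term», exact for quadratic actions over any field), `remB_add_remA_matrix` (`R₂ + R₂′ = H₀ᵀEH₀ − H₁ᵀEH₁`).
* §3 **BILINEAR READINGS** (lens 2's «BILINEAR pairing»): `bracket_bilinear` (`Bᵀ(P₁⁻¹ − P₀⁻¹)B′ = (H₀B)ᵀE(H₀B′) − (EH₀B)ᵀG₁(EH₀B′)` for two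
  block fields `B`, `B′` — polarised), `bracket_bilinear_diag`.
* §4 **THE LINE OVER `𝕜`**: `lineK K₀ E z = K₀ + z•E` (`z ∈ 𝕜`, e.g. complex), `lineK_sub`, and **`value_line_expand`** — for any two parameters
  `z, w` at which (H-inv) holds, `P_w⁻¹ − P_z⁻¹ = (w − z)•(H_zᵀ E H_z) − (w − z)²•((EH_z)ᵀ G_w (EH_z))`: lens 2's (E4) with the remainder EXACT and
  bilinear, no sign used anywhere — the complex-domain bookkeeping of tag (III)∕(IV) reduces to bounding ONE constrained propagator `G_w`.

HONEST FRAMING: [folklore] finite-dimensional algebra; a MODEL on an1's dictionary, nothing of Bałaban's operators or of B11 Prop 9's analytic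
continuation instantiated (the point typed is only: the quadratic identities need no reality); NOT (N1) ∕ (N1′) ∕ (N1-δ) ∕ K1-var(s) (the
quantitative `‖G_w‖` bound on the complex domain is the NEEDS item and is NOT supplied here) ∕ EJ-1c ∕ EJ-2 ∕ EJ-3; NOT a letter move; credit lens 1
g58 (E2), lens 2 g91 (E4).  NE7 NOT PRINTED ∕ NOT PROVED; spine 0∕9; FIXED FINITE T⁴, rung (B)+1; NOT infinite volume, NOT mass gap, NOT Clay.
HONEST DEPENDENCY: continuum YM on T⁴ ⇐ BetaPertH ∧ nine spine estimates (0/9 proved); BetaPertH ⇐ (D1) ∧ (D4) ∧ CAP+tail; G-an2-4 gates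
asym, D1 and NE2/3/4.
-/

noncomputable section

open Matrix

namespace Summit.QuantumFields.BalabanUV.T4Continuum.NE7EJBracketField

open Literature.MathematicalPhysics.QuantumFieldTheory.Balaban1983to89.Beta.Composition (blockProp)
open Literature.MathematicalPhysics.QuantumFieldTheory.Balaban1983to89.Beta.Envelope

variable {𝕜 : Type*} [Field 𝕜]
variable {ν μ : Type*} [Fintype ν] [Fintype μ] [DecidableEq ν] [DecidableEq μ]

/-! ### §1 Symmetry bookkeeping (symmetric, not Hermitian: valid over `ℂ` for complex-symmetric forms) -/

section Symm

variable {K : Matrix ν ν 𝕜}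

/-- the constrained propagator of a symmetric form is symmetric. [folklore] -/
theorem constrProp_transpose_of_symm (hKs : Kᵀ = K) (Q : Matrix μ ν 𝕜) : (constrProp K Q)ᵀ = constrProp K Q := by
  simp only [constrProp, minMap, blockProp_eq, transpose_sub, transpose_mul, transpose_transpose, transpose_nonsing_inv, hKs,
    Matrix.mul_assoc]

omit [Fintype μ] [DecidableEq μ] in
/-- the block propagator of a symmetric form is symmetric. [folklore] -/
theorem blockProp_transpose_of_symm (hKs : Kᵀ = K) (Q : Matrix μ ν 𝕜) : (blockProp K Q)ᵀ = blockProp K Q := by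
  rw [blockProp_eq, transpose_mul, transpose_mul, transpose_transpose, transpose_nonsing_inv, hKs, Matrix.mul_assoc]

/-- the value form of a symmetric form is symmetric. [folklore] -/
theorem blockPropInv_transpose_of_symm (hKs : Kᵀ = K) (Q : Matrix μ ν 𝕜) : ((blockProp K Q)⁻¹)ᵀ = (blockProp K Q)⁻¹ := by
  rw [transpose_nonsing_inv, blockProp_transpose_of_symm hKs]

end Symm

/-! ### §2 (E2) as matrix identities over `𝕜` -/

section E2

variable {K₀ K₁ : Matrix ν ν 𝕜} {Q : Matrix μ ν 𝕜}

/-- THE EXACT MINIMISER RESPONSE: `H₀ − H₁ = G₁ E H₀`, `E = K₁ − K₀` (an1's `minMap_sub_minMap`, rôles swapped). [folklore] -/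
theorem minMap_sub_eq (hK₀ : IsUnit K₀.det) (hK₁ : IsUnit K₁.det) (hP₀ : IsUnit (blockProp K₀ Q).det) (hP₁ : IsUnit (blockProp K₁ Q).det) :
    minMap K₀ Q - minMap K₁ Q = constrProp K₁ Q * (K₁ - K₀) * minMap K₀ Q := by
  rw [minMap_sub_minMap K₁ K₀ Q hK₁ hK₀ hP₁ hP₀, ← neg_sub K₁ K₀]
  simp only [Matrix.mul_neg, Matrix.neg_mul, neg_neg]

/-- **(E2) AS A MATRIX IDENTITY**: `P₁⁻¹ − P₀⁻¹ = H₀ᵀ E H₀ − (E H₀)ᵀ G₁ (E H₀)` for symmetric invertible `K₀`, `K₁` under (H-inv) — no sign,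
no positivity, any field. [folklore] -/
theorem value_sub_value_second (hK₀s : K₀ᵀ = K₀) (hK₁s : K₁ᵀ = K₁) (hK₀ : IsUnit K₀.det) (hK₁ : IsUnit K₁.det)
    (hP₀ : IsUnit (blockProp K₀ Q).det) (hP₁ : IsUnit (blockProp K₁ Q).det) :
    (blockProp K₁ Q)⁻¹ - (blockProp K₀ Q)⁻¹ =
      (minMap K₀ Q)ᵀ * (K₁ - K₀) * minMap K₀ Q -
        ((K₁ - K₀) * minMap K₀ Q)ᵀ * constrProp K₁ Q * ((K₁ - K₀) * minMap K₀ Q) := by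
  have hE : (K₁ - K₀)ᵀ = K₁ - K₀ := by rw [transpose_sub, hK₀s, hK₁s]
  have h1 := value_sub_value K₀ K₁ Q hK₀ hK₁ hP₀ hP₁
  rw [minMapL_eq_transpose K₀ Q hK₀s] at h1
  have h3 : minMap K₁ Q = minMap K₀ Q - constrProp K₁ Q * (K₁ - K₀) * minMap K₀ Q := by
    rw [← minMap_sub_eq hK₀ hK₁ hP₀ hP₁]; abel
  rw [h1, h3, transpose_mul, hE]
  generalize K₁ - K₀ = E
  rw [Matrix.mul_sub]
  simp only [Matrix.mul_assoc]

/-- the same from run B's side: `P₁⁻¹ − P₀⁻¹ = H₁ᵀ E H₁ + (E H₁)ᵀ G₀ (E H₁)`. [folklore] -/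
theorem value_sub_value_second' (hK₀s : K₀ᵀ = K₀) (hK₁s : K₁ᵀ = K₁) (hK₀ : IsUnit K₀.det) (hK₁ : IsUnit K₁.det)
    (hP₀ : IsUnit (blockProp K₀ Q).det) (hP₁ : IsUnit (blockProp K₁ Q).det) :
    (blockProp K₁ Q)⁻¹ - (blockProp K₀ Q)⁻¹ =
      (minMap K₁ Q)ᵀ * (K₁ - K₀) * minMap K₁ Q +
        ((K₁ - K₀) * minMap K₁ Q)ᵀ * constrProp K₀ Q * ((K₁ - K₀) * minMap K₁ Q) := by
  have h := value_sub_value_second hK₁s hK₀s hK₁ hK₀ hP₁ hP₀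
  rw [(neg_sub K₁ K₀).symm] at h
  simp only [Matrix.neg_mul, Matrix.mul_neg, transpose_neg, neg_neg] at h
  rw [← neg_sub (blockProp K₀ Q)⁻¹ (blockProp K₁ Q)⁻¹, h]
  abel

/-- **THE REMAINDER `R₂` AS A MATRIX**: `H₀ᵀ E H₀ − (P₁⁻¹ − P₀⁻¹) = (E H₀)ᵀ G₁ (E H₀)` — the defect form at run A's minimiser minus the bracket
form is the constrained-propagator form of the first variation (lens 2's `q`, bilinear). [folklore] -/
theorem remB_matrix (hK₀s : K₀ᵀ = K₀) (hK₁s : K₁ᵀ = K₁) (hK₀ : IsUnit K₀.det) (hK₁ : IsUnit K₁.det)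
    (hP₀ : IsUnit (blockProp K₀ Q).det) (hP₁ : IsUnit (blockProp K₁ Q).det) :
    (minMap K₀ Q)ᵀ * (K₁ - K₀) * minMap K₀ Q - ((blockProp K₁ Q)⁻¹ - (blockProp K₀ Q)⁻¹) =
      ((K₁ - K₀) * minMap K₀ Q)ᵀ * constrProp K₁ Q * ((K₁ - K₀) * minMap K₀ Q) := by
  rw [value_sub_value_second hK₀s hK₁s hK₀ hK₁ hP₀ hP₁, sub_sub_cancel]

/-- **`R₂` IS THE HESSIAN FORM OF THE MINIMISER DIFFERENCE**: `(E H₀)ᵀ G₁ (E H₀) = (H₀ − H₁)ᵀ K₁ (H₀ − H₁)` — lens 1's «R₂ = ½⟨W, Hess A_B W⟩,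
W = U^A − U^B, NO first-order term», exact over any field (`H₀ − H₁ = G₁EH₀`, `G₁ᵀ = G₁`, `G₁K₁G₁ = G₁`). [folklore] -/
theorem remB_matrix_eq_hessian_form (hK₁s : K₁ᵀ = K₁) (hK₀ : IsUnit K₀.det) (hK₁ : IsUnit K₁.det) (hP₀ : IsUnit (blockProp K₀ Q).det)
    (hP₁ : IsUnit (blockProp K₁ Q).det) :
    ((K₁ - K₀) * minMap K₀ Q)ᵀ * constrProp K₁ Q * ((K₁ - K₀) * minMap K₀ Q) =
      (minMap K₀ Q - minMap K₁ Q)ᵀ * K₁ * (minMap K₀ Q - minMap K₁ Q) := by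
  rw [minMap_sub_eq hK₀ hK₁ hP₀ hP₁]
  have h := constrProp_mul_mul_constrProp K₁ Q hK₁ hP₁
  simp only [transpose_mul, constrProp_transpose_of_symm hK₁s]
  -- (EH₀)ᵀ G₁ (EH₀) = (EH₀)ᵀ (G₁ K₁ G₁) (EH₀)
  conv_lhs => rw [← h]
  simp only [Matrix.mul_assoc]

/-- `R₂ + R₂′ = H₀ᵀ E H₀ − H₁ᵀ E H₁` as matrices (both remainders are constrained-propagator forms). [folklore] -/
theorem remB_add_remA_matrix (hK₀s : K₀ᵀ = K₀) (hK₁s : K₁ᵀ = K₁) (hK₀ : IsUnit K₀.det) (hK₁ : IsUnit K₁.det)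
    (hP₀ : IsUnit (blockProp K₀ Q).det) (hP₁ : IsUnit (blockProp K₁ Q).det) :
    ((K₁ - K₀) * minMap K₀ Q)ᵀ * constrProp K₁ Q * ((K₁ - K₀) * minMap K₀ Q) +
        ((K₁ - K₀) * minMap K₁ Q)ᵀ * constrProp K₀ Q * ((K₁ - K₀) * minMap K₁ Q) =
      (minMap K₀ Q)ᵀ * (K₁ - K₀) * minMap K₀ Q - (minMap K₁ Q)ᵀ * (K₁ - K₀) * minMap K₁ Q := by
  have h1 := value_sub_value_second hK₀s hK₁s hK₀ hK₁ hP₀ hP₁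
  have h2 := value_sub_value_second' hK₀s hK₁s hK₀ hK₁ hP₀ hP₁
  -- subtract the two expressions of the same matrix
  have h3 : (minMap K₀ Q)ᵀ * (K₁ - K₀) * minMap K₀ Q -
        ((K₁ - K₀) * minMap K₀ Q)ᵀ * constrProp K₁ Q * ((K₁ - K₀) * minMap K₀ Q) =
      (minMap K₁ Q)ᵀ * (K₁ - K₀) * minMap K₁ Q +
        ((K₁ - K₀) * minMap K₁ Q)ᵀ * constrProp K₀ Q * ((K₁ - K₀) * minMap K₁ Q) := by rw [← h1, ← h2]
  generalize ((K₁ - K₀) * minMap K₀ Q)ᵀ * constrProp K₁ Q * ((K₁ - K₀) * minMap K₀ Q) = R₂ at h3 ⊢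
  generalize ((K₁ - K₀) * minMap K₁ Q)ᵀ * constrProp K₀ Q * ((K₁ - K₀) * minMap K₁ Q) = R₂' at h3 ⊢
  generalize (minMap K₀ Q)ᵀ * (K₁ - K₀) * minMap K₀ Q = FA at h3 ⊢
  generalize (minMap K₁ Q)ᵀ * (K₁ - K₀) * minMap K₁ Q = FB at h3 ⊢
  rw [sub_eq_iff_eq_add] at h3
  rw [h3]; abel

end E2

/-! ### §3 Bilinear readings (no `star`): the bracket of two block fields -/

section Bilinear

variable {K₀ K₁ : Matrix ν ν 𝕜} {Q : Matrix μ ν 𝕜}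

omit [DecidableEq ν] [DecidableEq μ] in
/-- `⟨M x, w⟩ = ⟨x, Mᵀ w⟩` (bilinear). [folklore] -/
theorem mulVec_dotProduct_eq (M : Matrix ν μ 𝕜) (x : μ → 𝕜) (w : ν → 𝕜) : (M *ᵥ x) ⬝ᵥ w = x ⬝ᵥ (Mᵀ *ᵥ w) := by
  rw [dotProduct_comm, dotProduct_mulVec, ← mulVec_transpose, dotProduct_comm]

omit [DecidableEq ν] [DecidableEq μ] in
/-- matrix-to-bilinear-form transfer: `B ⬝ᵥ (Xᵀ M X) B′ = (X B) ⬝ᵥ M (X B′)`. [folklore] -/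
theorem dot_conj_mulVec {ρ : Type*} [Fintype ρ] (X : Matrix ρ μ 𝕜) (M : Matrix ρ ρ 𝕜) (B B' : μ → 𝕜) :
    B ⬝ᵥ ((Xᵀ * M * X) *ᵥ B') = (X *ᵥ B) ⬝ᵥ (M *ᵥ (X *ᵥ B')) := by
  rw [mulVec_dotProduct_eq, mulVec_mulVec, mulVec_mulVec]

/-- **THE POLARISED BRACKET**: for two block fields `B`, `B′`,
`B ⬝ᵥ (P₁⁻¹ − P₀⁻¹) B′ = (H₀B) ⬝ᵥ E (H₀B′) − (E H₀ B) ⬝ᵥ G₁ (E H₀ B′)` — bilinear, any field (lens 2's «BILINEAR pairing» for complex `V`).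
[folklore] -/
theorem bracket_bilinear (hK₀s : K₀ᵀ = K₀) (hK₁s : K₁ᵀ = K₁) (hK₀ : IsUnit K₀.det) (hK₁ : IsUnit K₁.det)
    (hP₀ : IsUnit (blockProp K₀ Q).det) (hP₁ : IsUnit (blockProp K₁ Q).det) (B B' : μ → 𝕜) :
    B ⬝ᵥ (((blockProp K₁ Q)⁻¹ - (blockProp K₀ Q)⁻¹) *ᵥ B') =
      (minMap K₀ Q *ᵥ B) ⬝ᵥ ((K₁ - K₀) *ᵥ (minMap K₀ Q *ᵥ B')) -
        ((K₁ - K₀) *ᵥ (minMap K₀ Q *ᵥ B)) ⬝ᵥ (constrProp K₁ Q *ᵥ ((K₁ - K₀) *ᵥ (minMap K₀ Q *ᵥ B'))) := by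
  rw [value_sub_value_second hK₀s hK₁s hK₀ hK₁ hP₀ hP₁, sub_mulVec, dotProduct_sub, dot_conj_mulVec, dot_conj_mulVec]
  simp only [← mulVec_mulVec]

/-- the diagonal `B′ = B`: `Br(B) = 𝔇-form(H₀B) − q(B)` with `q(B) = (EH₀B) ⬝ᵥ G₁ (EH₀B)` bilinear. [folklore] -/
theorem bracket_bilinear_diag (hK₀s : K₀ᵀ = K₀) (hK₁s : K₁ᵀ = K₁) (hK₀ : IsUnit K₀.det) (hK₁ : IsUnit K₁.det)
    (hP₀ : IsUnit (blockProp K₀ Q).det) (hP₁ : IsUnit (blockProp K₁ Q).det) (B : μ → 𝕜) :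
    B ⬝ᵥ (((blockProp K₁ Q)⁻¹ - (blockProp K₀ Q)⁻¹) *ᵥ B) =
      (minMap K₀ Q *ᵥ B) ⬝ᵥ ((K₁ - K₀) *ᵥ (minMap K₀ Q *ᵥ B)) -
        ((K₁ - K₀) *ᵥ (minMap K₀ Q *ᵥ B)) ⬝ᵥ (constrProp K₁ Q *ᵥ ((K₁ - K₀) *ᵥ (minMap K₀ Q *ᵥ B))) :=
  bracket_bilinear hK₀s hK₁s hK₀ hK₁ hP₀ hP₁ B B

end Bilinear

/-! ### §4 The line `K_z = K₀ + z•E` over `𝕜` (e.g. a complex parameter): the exact (E4) expansion between two parameters -/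

section Line

/-- the LINE OF FORMS over `𝕜`: `K_z := K₀ + z•E`. [folklore] -/
def lineK (K₀ E : Matrix ν ν 𝕜) (z : 𝕜) : Matrix ν ν 𝕜 := K₀ + z • E

variable (K₀ E : Matrix ν ν 𝕜)

omit [Fintype ν] [Fintype μ] [DecidableEq ν] [DecidableEq μ] in
/-- unfolding. [folklore] -/
@[simp] theorem lineK_apply (z : 𝕜) : lineK K₀ E z = K₀ + z • E := rfl

omit [Fintype ν] [Fintype μ] [DecidableEq ν] [DecidableEq μ] in
/-- `K_w − K_z = (w − z)•E`. [folklore] -/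
theorem lineK_sub (w z : 𝕜) : lineK K₀ E w - lineK K₀ E z = (w - z) • E := by
  simp only [lineK_apply, sub_smul]; abel

omit [Fintype ν] [Fintype μ] [DecidableEq ν] [DecidableEq μ] in
/-- symmetric data give a symmetric line. [folklore] -/
theorem lineK_transpose (hK₀s : K₀ᵀ = K₀) (hEs : Eᵀ = E) (z : 𝕜) : (lineK K₀ E z)ᵀ = lineK K₀ E z := by
  rw [lineK_apply, transpose_add, transpose_smul, hK₀s, hEs]

variable {K₀ E} {Q : Matrix μ ν 𝕜}

/-- **THE EXACT (E4) EXPANSION OVER `𝕜`**: at any two parameters `z`, `w` where (H-inv) holds,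
`P_w⁻¹ − P_z⁻¹ = (w − z)•(H_zᵀ E H_z) − (w − z)²•((E H_z)ᵀ G_w (E H_z))` — first order = the defect form at the minimiser (Hellmann–Feynman),
remainder = `(w−z)²` × a constrained-propagator form; NO sign used (lens 2's «analytic identities in V wherever … (H-inv) holds»). [folklore] -/
theorem value_line_expand (hK₀s : K₀ᵀ = K₀) (hEs : Eᵀ = E) {z w : 𝕜} (hz : IsUnit (lineK K₀ E z).det) (hw : IsUnit (lineK K₀ E w).det)
    (hPz : IsUnit (blockProp (lineK K₀ E z) Q).det) (hPw : IsUnit (blockProp (lineK K₀ E w) Q).det) :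
    (blockProp (lineK K₀ E w) Q)⁻¹ - (blockProp (lineK K₀ E z) Q)⁻¹ =
      (w - z) • ((minMap (lineK K₀ E z) Q)ᵀ * E * minMap (lineK K₀ E z) Q) -
        (w - z) ^ 2 • ((E * minMap (lineK K₀ E z) Q)ᵀ * constrProp (lineK K₀ E w) Q * (E * minMap (lineK K₀ E z) Q)) := by
  rw [value_sub_value_second (lineK_transpose K₀ E hK₀s hEs z) (lineK_transpose K₀ E hK₀s hEs w) hz hw hPz hPw, lineK_sub]
  simp only [Matrix.smul_mul, Matrix.mul_smul, transpose_smul, smul_smul, pow_two, Matrix.mul_assoc]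

/-- its bilinear reading on a block field `B`: `B ⬝ᵥ (P_w⁻¹ − P_z⁻¹) B = (w−z)·(H_zB) ⬝ᵥ E (H_zB) − (w−z)²·(EH_zB) ⬝ᵥ G_w (EH_zB)`. [folklore] -/
theorem value_line_expand_bilinear (hK₀s : K₀ᵀ = K₀) (hEs : Eᵀ = E) {z w : 𝕜} (hz : IsUnit (lineK K₀ E z).det)
    (hw : IsUnit (lineK K₀ E w).det) (hPz : IsUnit (blockProp (lineK K₀ E z) Q).det) (hPw : IsUnit (blockProp (lineK K₀ E w) Q).det)
    (B : μ → 𝕜) :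
    B ⬝ᵥ (((blockProp (lineK K₀ E w) Q)⁻¹ - (blockProp (lineK K₀ E z) Q)⁻¹) *ᵥ B) =
      (w - z) * ((minMap (lineK K₀ E z) Q *ᵥ B) ⬝ᵥ (E *ᵥ (minMap (lineK K₀ E z) Q *ᵥ B))) -
        (w - z) ^ 2 * ((E *ᵥ (minMap (lineK K₀ E z) Q *ᵥ B)) ⬝ᵥ
          (constrProp (lineK K₀ E w) Q *ᵥ (E *ᵥ (minMap (lineK K₀ E z) Q *ᵥ B)))) := by
  rw [value_line_expand hK₀s hEs hz hw hPz hPw, sub_mulVec, dotProduct_sub, smul_mulVec, smul_mulVec, dotProduct_smul,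
    dotProduct_smul, smul_eq_mul, smul_eq_mul, dot_conj_mulVec, dot_conj_mulVec]
  simp only [← mulVec_mulVec]

end Line

end Summit.QuantumFields.BalabanUV.T4Continuum.NE7EJBracketField

end
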